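import Summits.QuantumFields.YangMills.Theorems.ColdStartUniversalityLatticeLangevinLiebRobinsonCouplingLipschitz
import Summits.QuantumFields.YangMills.Theorems.ColdStartUniversalityUniformColdStartMixingFixedCutoffMixingTimeWindow
import Summits.QuantumFields.YangMills.Theorems.ColdStartUniversalityUniformColdStartMixingFixedCutoffEquilibriumWindow
import HarnessLib

/-!
# Route `ColdStartUniversality` (fixed-cut-off SZZ dynamics; LIEB–ROBINSON / LOCALITY package, file 25):
# the clustering and coupling-response theorems AT THE ROUTE'S CUT-OFFS inside the window `γε_K > 6`

Helper file (seat `ym-line-csu-p1`, g31; `--supports stmt-QuantumFields-24809`).  The route runs the `SU(2)` SZZ dynamics on the `K`-th lattice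
`(ℤ/N_K)³`, `N_K = (F.P K).sitesPerDir 0`, at `β'_K = (γε_K)⁻¹/2`; the strong-coupling window `|β'_K| < 1/12` is `γε_K > 6`
(`window_coupling_bounds`).  Read there, files 16–21 say (constants depend on `γε_K` only, NOT on `N_K`):
* ★★★ `wilson_loop_covariance_fixedCutoff_window` — exponential clustering of Wilson loops under `μ_K = wilsonMeasure ρ_fund β'_K`;
* ★★★ `wilson_action_variance_fixedCutoff_window` — `Var_(μ_K)(S_W) ≤ 3N_K³ · C(γε_K)`: specific heat per plaquette bounded independently of `N_K`;
* ★★★ `abs_deriv_wilson_loop_expectation_fixedCutoff_window` — the `β'`-derivative of `⟨Re tr w⟩` at `β'_K` is bounded independently of `N_K`.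
THEOREMS ONLY, no definition, no sorry; [folklore].  HONEST FRAMING: these hold INSIDE THE WINDOW `γε_K > 6` only, i.e. for the first few cut-offs
(`ε_K → 0` leaves it); they are NOT cut-off-uniform statements and say nothing about `UniformColdStartMixing` (24809, NOT restated) or the continuum
limit; no crux, rung or summit statement is proved; the Yang–Mills mass gap is NOT proved.
-/

set_option autoImplicit false

noncomputable section

namespace Summit.QuantumFields.YangMills.Theorems.ColdStartUniversality.LiebRobinson

open MeasureTheory ProbabilityTheory Matrix Complex Finset Filter Set Metric
open scoped ComplexConjugate BigOperators Matrix NNReal ENNReal Topology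
open Literature.Probability.Process Literature.MathematicalPhysics.QuantumFieldTheory
open Literature.MathematicalPhysics.QuantumFieldTheory.Balaban1983to89
open Literature.MathematicalPhysics.QuantumLattice (fundamentalRep fundamentalLatticeRep continuous_fundamentalRep fundamentalRep_apply)

/-- ★★★ **Exponential clustering of Wilson loops at the route's cut-offs inside the window.**  For `6 < γε_K`, two loop words on `(ℤ/N_K)³` whose
links have base sites at cyclic sup-distance `≥ R+1`:
`|⟨Re tr w₁·Re tr w₂⟩_(μ_K) − ⟨Re tr w₁⟩⟨Re tr w₂⟩| ≤ 32π²|w₁|²|w₂|²(1 + T_R)e^(−ρ_K T_R)`, `ρ_K = 1 − 12|β'_K| = 1 − 6/(γε_K)`, `λ_K = (1300+4√2)|β'_K|`,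
`T_R = (R+1) log 108/(λ_K+ρ_K)` — no `N_K` anywhere. [folklore] -/
theorem wilson_loop_covariance_fixedCutoff_window (F : T3ContinuumYM3Torus.T3Family) (γ : ℝ) (K : ℕ) (hK : 6 < γ * (F.P K).eps)
    (l₁ l₂ : List (Edge 3 ((F.P K).sitesPerDir 0) × Bool)) (R : ℕ)
    (hsep : ∀ e' ∈ (l₁.map Prod.fst).toFinset, ∀ e ∈ (l₂.map Prod.fst).toFinset, R + 1 ≤ (Finset.univ.sup fun i : Fin 3 => ((e'.1 i - e.1 i).valMinAbs).natAbs)) :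
    let coords : GaugeConfig 3 ((F.P K).sitesPerDir 0) (Matrix.specialUnitaryGroup (Fin 2) ℂ) → (Edge 3 ((F.P K).sitesPerDir 0) × Fin 2 × Fin 2 × Bool → ℝ) :=
      fun V q => (fun z : ℂ => if q.2.2.2 then z.im else z.re)
        ((fundamentalRep (Fin 2) (V q.1) : Matrix (Fin 2) (Fin 2) ℂ) q.2.1 q.2.2.1)
    |(∫ x, (fun y : (Edge 3 ((F.P K).sitesPerDir 0) × Fin 2 × Fin 2 × Bool → ℝ) => ((l₁.map (fun a : Edge 3 ((F.P K).sitesPerDir 0) × Bool => if a.2 then ((fun (ee : Edge 3 ((F.P K).sitesPerDir 0)) => Matrix.of fun (i j : Fin 2) => ((y (ee, i, j, false) : ℝ) : ℂ) + ((y (ee, i, j, true) : ℝ) : ℂ) * Complex.I) a.1)ᴴ else (fun (ee : Edge 3 ((F.P K).sitesPerDir 0)) => Matrix.of fun (i j : Fin 2) => ((y (ee, i, j, false) : ℝ) : ℂ) + ((y (ee, i, j, true) : ℝ) : ℂ) * Complex.I) a.1)).prod).trace.re) (coords x) * (fun y : (Edge 3 ((F.P K).sitesPerDir 0) × Fin 2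 × Fin 2 × Bool → ℝ) => ((l₂.map (fun a : Edge 3 ((F.P K).sitesPerDir 0) × Bool => if a.2 then ((fun (ee : Edge 3 ((F.P K).sitesPerDir 0)) => Matrix.of fun (i j : Fin 2) => ((y (ee, i, j, false) : ℝ) : ℂ) + ((y (ee, i, j, true) : ℝ) : ℂ) * Complex.I) a.1)ᴴ else (fun (ee : Edge 3 ((F.P K).sitesPerDir 0)) => Matrix.of fun (i j : Fin 2) => ((y (ee, i, j, false) : ℝ) : ℂ) + ((y (ee, i, j, true) : ℝ) : ℂ) * Complex.I) a.1)).prod).trace.re) (coords x) ∂(wilsonMeasure (d := 3) (L := ((F.P K).sitesPerDir 0)) (fundamentalRep (Fin 2)) ((γ * (F.P K).eps)⁻¹ / 2))) -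
        (∫ x, (fun y : (Edge 3 ((F.P K).sitesPerDir 0) × Fin 2 × Fin 2 × Bool → ℝ) => ((l₁.map (fun a : Edge 3 ((F.P K).sitesPerDir 0) × Bool => if a.2 then ((fun (ee : Edge 3 ((F.P K).sitesPerDir 0)) => Matrix.of fun (i j : Fin 2) => ((y (ee, i, j, false) : ℝ) : ℂ) + ((y (ee, i, j, true) : ℝ) : ℂ) * Complex.I) a.1)ᴴ else (fun (ee : Edge 3 ((F.P K).sitesPerDir 0)) => Matrix.of fun (i j : Fin 2) => ((y (ee, i, j, false) : ℝ) : ℂ) + ((y (ee, i, j, true) : ℝ) : ℂ) * Complex.I) a.1)).prod).trace.re) (coords x) ∂(wilsonMeasure (d := 3) (L := ((F.P K).sitesPerDir 0)) (fundamentalRep (Fin 2)) ((γ * (F.P K).eps)⁻¹ / 2))) * (∫ x, (fun y : (Edge 3 ((F.P K).sitesPerDir 0) × Fin 2 × Fin 2 × Bool → ℝ) => ((l₂.map (fun a : Edge 3 ((F.P K).sitesPerDir 0) × Bool => if a.2 then ((fun (ee : Edge 3 ((F.P K).sitesPerDir 0)) => Matrix.of fun (i j : Fin 2) => ((y (ee,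 i, j, false) : ℝ) : ℂ) + ((y (ee, i, j, true) : ℝ) : ℂ) * Complex.I) a.1)ᴴ else (fun (ee : Edge 3 ((F.P K).sitesPerDir 0)) => Matrix.of fun (i j : Fin 2) => ((y (ee, i, j, false) : ℝ) : ℂ) + ((y (ee, i, j, true) : ℝ) : ℂ) * Complex.I) a.1)).prod).trace.re) (coords x) ∂(wilsonMeasure (d := 3) (L := ((F.P K).sitesPerDir 0)) (fundamentalRep (Fin 2)) ((γ * (F.P K).eps)⁻¹ / 2)))| ≤
      32 * Real.pi ^ 2 * (l₁.length : ℝ) ^ 2 * (l₂.length : ℝ) ^ 2 * (1 + (((R : ℝ) + 1) * Real.log 108 / ((1300 + 4 * Real.sqrt 2) * |((γ * (F.P K).eps)⁻¹ / 2)| + (1 - 12 * |((γ * (F.P K).eps)⁻¹ / 2)|)))) * Real.exp (-((1 - 12 * |((γ * (F.P K).eps)⁻¹ / 2)|) * (((R : ℝ) + 1) * Real.log 108 / ((1300 + 4 * Real.sqrt 2) * |((γ * (F.P K).eps)⁻¹ / 2)| + (1 - 12 * |((γ * (F.P K).eps)⁻¹ / 2)|))))) := by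
  obtain ⟨hβ, -⟩ := window_coupling_bounds F γ K hK
  exact wilson_loop_covariance_abs_le ((F.P K).sitesPerDir 0) ((γ * (F.P K).eps)⁻¹ / 2) hβ l₁ l₂ R hsep

/-- ★★★ **Volume-uniform specific heat at the route's cut-offs inside the window**: for `6 < γε_K`,
`Var_(μ_K)(S_W) ≤ 3N_K³ · 12(16384π²/ρ_K)e^(κ_K)(1+12/κ_K)³/(1−e^(−κ_K/2))`, `κ_K = ρ_K log 108/(2(λ_K+ρ_K))` — linear in the number of plaquettes
`3N_K³`, with a slope depending on `γε_K` only. [folklore] -/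
theorem wilson_action_variance_fixedCutoff_window (F : T3ContinuumYM3Torus.T3Family) (γ : ℝ) (K : ℕ) (hK : 6 < γ * (F.P K).eps) :
    ∫ x, (Literature.MathematicalPhysics.QuantumFieldTheory.wilsonAction (fundamentalRep (Fin 2)) x - ∫ z, Literature.MathematicalPhysics.QuantumFieldTheory.wilsonAction (fundamentalRep (Fin 2)) z ∂(wilsonMeasure (d := 3) (L := ((F.P K).sitesPerDir 0)) (fundamentalRep (Fin 2)) ((γ * (F.P K).eps)⁻¹ / 2))) ^ 2 ∂(wilsonMeasure (d := 3) (L := ((F.P K).sitesPerDir 0)) (fundamentalRep (Fin 2)) ((γ * (F.P K).eps)⁻¹ / 2)) ≤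
      (3 * ((((((F.P K).sitesPerDir 0)) : ℕ) : ℝ)) ^ 3) * (3 * (4 : ℝ) * ((1024 * Real.pi ^ 2 * (4 : ℝ) ^ 2 / (1 - 12 * |((γ * (F.P K).eps)⁻¹ / 2)|)) * Real.exp ((1 - 12 * |((γ * (F.P K).eps)⁻¹ / 2)|) * Real.log 108 / (2 * ((1300 + 4 * Real.sqrt 2) * |((γ * (F.P K).eps)⁻¹ / 2)| + (1 - 12 * |((γ * (F.P K).eps)⁻¹ / 2)|))))) * ((1 + 12 / ((1 - 12 * |((γ * (F.P K).eps)⁻¹ / 2)|) * Real.log 108 / (2 * ((1300 + 4 * Real.sqrt 2) * |((γ * (F.P K).eps)⁻¹ / 2)| + (1 - 12 * |((γ * (F.P K).eps)⁻¹ / 2)|))))) ^ 3 / (1 - Real.exp (-(((1 - 12 * |((γ * (F.P K).eps)⁻¹ / 2)|) * Real.log 108 / (2 * ((1300 + 4 * Real.sqrt 2) * |((γ * (F.P K).eps)⁻¹ / 2)| + (1 - 12 * |((γ * (F.P K).eps)⁻¹ / 2)|)))) / 2))))) := by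
  obtain ⟨hβ, -⟩ := window_coupling_bounds F γ K hK
  have h := wilson_action_variance_le ((F.P K).sitesPerDir 0) ((γ * (F.P K).eps)⁻¹ / 2) hβ
  rw [(card_site_plaquette_fixedCutoff F K).2] at h
  exact h

/-- ★★★ **The coupling derivative of Wilson loops at the route's cut-offs is bounded independently of the volume** (inside the window): for
`6 < γε_K` and a non-empty word `w` on `(ℤ/N_K)³`,
`|d/db ⟨Re tr w⟩_(wilsonMeasure ρ b)|_(b = β'_K)| ≤ 3|w|(1024π²|w|²/ρ_K)e^(κ_K)(1+12/κ_K)³/(1−e^(−κ_K/2))` — no `N_K`. [folklore] -/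
theorem abs_deriv_wilson_loop_expectation_fixedCutoff_window (F : T3ContinuumYM3Torus.T3Family) (γ : ℝ) (K : ℕ) (hK : 6 < γ * (F.P K).eps)
    (l₁ : List (Edge 3 ((F.P K).sitesPerDir 0) × Bool)) (hl₁ : l₁ ≠ []) :
    let coords : GaugeConfig 3 ((F.P K).sitesPerDir 0) (Matrix.specialUnitaryGroup (Fin 2) ℂ) → (Edge 3 ((F.P K).sitesPerDir 0) × Fin 2 × Fin 2 × Bool → ℝ) :=
      fun V q => (fun z : ℂ => if q.2.2.2 then z.im else z.re)
        ((fundamentalRep (Fin 2) (V q.1) : Matrix (Fin 2) (Fin 2) ℂ) q.2.1 q.2.2.1)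
    |deriv (fun b : ℝ => ∫ x, (fun y : (Edge 3 ((F.P K).sitesPerDir 0) × Fin 2 × Fin 2 × Bool → ℝ) => ((l₁.map (fun a : Edge 3 ((F.P K).sitesPerDir 0) × Bool => if a.2 then ((fun (ee : Edge 3 ((F.P K).sitesPerDir 0)) => Matrix.of fun (i j : Fin 2) => ((y (ee, i, j, false) : ℝ) : ℂ) + ((y (ee, i, j, true) : ℝ) : ℂ) * Complex.I) a.1)ᴴ else (fun (ee : Edge 3 ((F.P K).sitesPerDir 0)) => Matrix.of fun (i j : Fin 2) => ((y (ee, i, j, false) : ℝ) : ℂ) + ((y (ee, i, j, true) : ℝ) : ℂ) * Complex.I) a.1)).prod).trace.re) (coords x) ∂(wilsonMeasure (d := 3) (L := ((F.P K).sitesPerDir 0)) (fundamentalRep (Fin 2)) b)) ((γ * (F.P K).eps)⁻¹ / 2)| ≤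
      3 * (l₁.length : ℝ) * ((1024 * Real.pi ^ 2 * (l₁.length : ℝ) ^ 2 / (1 - 12 * |((γ * (F.P K).eps)⁻¹ / 2)|)) * Real.exp ((1 - 12 * |((γ * (F.P K).eps)⁻¹ / 2)|) * Real.log 108 / (2 * ((1300 + 4 * Real.sqrt 2) * |((γ * (F.P K).eps)⁻¹ / 2)| + (1 - 12 * |((γ * (F.P K).eps)⁻¹ / 2)|))))) * ((1 + 12 / ((1 - 12 * |((γ * (F.P K).eps)⁻¹ / 2)|) * Real.log 108 / (2 * ((1300 + 4 * Real.sqrt 2) * |((γ * (F.P K).eps)⁻¹ / 2)| + (1 - 12 * |((γ * (F.P K).eps)⁻¹ / 2)|))))) ^ 3 / (1 - Real.exp (-(((1 - 12 * |((γ * (F.P K).eps)⁻¹ / 2)|) * Real.log 108 / (2 * ((1300 + 4 * Real.sqrt 2) * |((γ * (F.P K).eps)⁻¹ / 2)| + (1 - 12 * |((γ * (F.P K).eps)⁻¹ / 2)|)))) / 2)))) := by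
  obtain ⟨hβ, -⟩ := window_coupling_bounds F γ K hK
  exact abs_deriv_wilson_loop_expectation_le ((F.P K).sitesPerDir 0) ((γ * (F.P K).eps)⁻¹ / 2) hβ l₁ hl₁

end Summit.QuantumFields.YangMills.Theorems.ColdStartUniversality.LiebRobinson
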